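import Summits.BirchSwinnertonDyer.BirchSwinnertonDyer.Theorems.KimAtThreeFineKatoDefinedLambda
import Summits.BirchSwinnertonDyer.BirchSwinnertonDyer.Theorems.KimAtThreeDeepUpperZetaBodyC3Uniform
import HarnessLib

/-!
# Kato's value datum DEFINED, III′ — `ZetaBody` (C3a)/(C3b) for `katoLambda` on EVERY tower row (stratum-free),
# keyed on w2-c3 g9's `zetaBody_C3_of_level_of_ne_zero` (crux `KatoKuriharaPortThreeShared`, stmt-BirchSwinnertonDyer-19560,
# and the deep family 19075/19076/19562/20013; cell `bsd-addord`, seat w2-acc5 gen 6; `--supports 19560`, helper)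

HONEST FRAMING.  ONE TOOL theorem (no definition, no named fact, no instance, no `sorry`); closes nothing; nothing is
booked; BSD is not proved by any of this.

WHAT.  `KimAtThreeFineKatoDefinedLambda.zetaBody_C3_katoLambda` proves (C3a) ∧ (C3b) for the DEFINED `Λ := katoLambda …` at
`p = 3` on the Kato STRATUM (Addv, `3 ∤ c₃`, `E(ℚ₃)[3] = 0`, `hdual` — kim3 g15's `zetaBody_C3_of_level`).  w2-c3 g9's
`KimAtThreeDeepUpperZetaBodyC3Uniform.zetaBody_C3_of_level_of_ne_zero` (p525561) replaced those four binders by the one thing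
they fed, a class `y` with `exp*_d y ≠ 0` (supplied on every row by their `exists_expStarOmegaAt_ne_zero_of_hdual` /
`…_of_facts`).  THIS FILE is the same re-keying for the defined datum: `zetaBody_C3_katoLambda_of_ne_zero` = their lemma with
its (DEF₀) hypothesis DISCHARGED by `cocycleDef_katoLambda` — so the deep-family port of the Λ-free road (w2-c3, «hKatoDefᵘ →
hKatoExᵘ») and the LEAD's stratum road read (C3) for `katoLambda` from (RES₀) + `∃ y, exp*_d y ≠ 0` alone (HOME STATUS
2026-08-27T11:01:17Z COORD).

References: K. Kato, Astérisque 295 (2004) §9.4 [Kato2004Asterisque]; K. Kato, LNM 1553 (1993) II §1.2.4, Prop. 1.2.3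
[Kato1993LNM1553]; J. Neukirch, *ANT* (1999) II §9 (9.6) [NeukirchANT1999]; J.-P. Serre, *Local Fields* (1979) VII §5
[SerreLocalFields1979].
-/

noncomputable section

-- the cell's Theorems namespace `Summit.BirchSwinnertonDyer.BirchSwinnertonDyer.…` repeats the summit name by design (D-0017)
set_option linter.dupNamespace false

open scoped Classical NumberField TensorProduct ContRepresentation Pointwise
open Field ValuativeRel Function IsDedekindDomain NumberField
open WeierstrassCurve Literature.NumberTheory.EllipticCurves Literature.NumberTheory.GaloisRepresentations
  Literature.NumberTheory.GaloisRepresentations.DiscreteGaloisModule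
open Literature.NumberTheory.GaloisRepresentations.PeriodRingData Literature.NumberTheory.PAdicHodge
open Literature.NumberTheory.EllipticCurves.ModularForms Literature.NumberTheory.EllipticCurves.Rank1Residual
open Literature.NumberTheory.EllipticCurves.Kato2004 Literature.NumberTheory.EllipticCurves.Kato2004.EulerSystemValues
open Literature.NumberTheory.AdelicBaseChange Literature.NumberTheory.Automorphic
open Summit.BirchSwinnertonDyer.Rank1Residual.GaloisImage
open Summit.BirchSwinnertonDyer.Rank1Residual.Additive.LocalLog
open Summit.BirchSwinnertonDyer.BirchSwinnertonDyer.Theorems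
open Summit.BirchSwinnertonDyer.BirchSwinnertonDyer.Theorems.KimAtThreeFineKatoPerFactorDefined
open Summit.BirchSwinnertonDyer.BirchSwinnertonDyer.Theorems.KimAtThreeDeepLowerExpStarOmega
open Summit.BirchSwinnertonDyer.BirchSwinnertonDyer.Theorems.KimAtThreeDeepLowerExpStarOmegaPlace
open Summit.BirchSwinnertonDyer.BirchSwinnertonDyer.Theorems.KimAtThreeFineKatoPerFactorPlaces
open Summit.BirchSwinnertonDyer.BirchSwinnertonDyer.Theorems.KimAtThreeFineKatoDefinedLambda
open Summit.BirchSwinnertonDyer.BirchSwinnertonDyer.Theorems.KimAtThreeDeepUpperZetaBodyC3Uniform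

namespace Summit.BirchSwinnertonDyer.BirchSwinnertonDyer.Theorems.KimAtThreeFineKatoDefinedLambdaC3Uniform

set_option backward.isDefEq.respectTransparency false in
set_option maxHeartbeats 400000 in
/-- **`ZetaBody` (C3a) ∧ (C3b) for `Λ_{k,r} := katoLambda …` at `p = 3` on EVERY tower row** — w2-c3 g9's
`zetaBody_C3_of_level_of_ne_zero` (text otherwise byte-identical to kim3's `zetaBody_C3_of_level`, the Kato-stratum binders
and `hdual` replaced by `∃ y, exp*_d y ≠ 0`) with the (DEF₀) hypothesis DISCHARGED by `cocycleDef_katoLambda`: for the defined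
datum the two own-attribution clauses cost (RES₀) and one class with `exp*_d ≠ 0` only (`maxHeartbeats 400000` as in the lemma
it instantiates). [cite: Kato2004Asterisque, §9.4 (p. 188)] [cite: Kato1993LNM1553, Ch. II §1.2.4 and Prop. 1.2.3]
[cite: NeukirchANT1999, Ch. II §9 Prop. (9.6)] [cite: SerreLocalFields1979, VII §5 Prop. 3] -/
theorem zetaBody_C3_katoLambda_of_ne_zero (W : WeierstrassCurve ℚ) [W.IsElliptic] [W.IsGloballyMinimal]
    [ContinuousSMul ℤ_[3] (W.tateModule 3)] [Module.Free ℤ_[3] (W.tateModule 3)]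
    [Module.Finite ℤ_[3] (W.tateModule 3)]
    (k : ℕ) (r : Finset (HeightOneSpectrum (𝓞 ℚ))) :
    haveI : Fact (((3 : ℕ) : 𝓞 ℚ) ∈ ((Rat.HeightOneSpectrum.primesEquiv (R := 𝓞 ℚ)).symm ⟨3, Fact.out⟩).asIdeal) :=
      ⟨(natCast_mem_asIdeal_iff_eq_primesEquiv_symm _ Nat.prime_three).mpr rfl⟩
    letI := valuativeRelPlace ((Rat.HeightOneSpectrum.primesEquiv (R := 𝓞 ℚ)).symm ⟨3, Fact.out⟩)
    letI := topologicalSpacePlace ((Rat.HeightOneSpectrum.primesEquiv (R := 𝓞 ℚ)).symm ⟨3, Fact.out⟩)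
    haveI := isNonarchimedeanLocalField_place ((Rat.HeightOneSpectrum.primesEquiv (R := 𝓞 ℚ)).symm ⟨3, Fact.out⟩)
    haveI := charZero_place ((Rat.HeightOneSpectrum.primesEquiv (R := 𝓞 ℚ)).symm ⟨3, Fact.out⟩)
    letI := padicAlgebraPlace 3 ((Rat.HeightOneSpectrum.primesEquiv (R := 𝓞 ℚ)).symm ⟨3, Fact.out⟩)
    haveI := fact_not_isUnit_place 3 ((Rat.HeightOneSpectrum.primesEquiv (R := 𝓞 ℚ)).symm ⟨3, Fact.out⟩)
    haveI := isAdicComplete_place 3 ((Rat.HeightOneSpectrum.primesEquiv (R := 𝓞 ℚ)).symm ⟨3, Fact.out⟩)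
    ∀ (d : LocalNeronLineAt W 3 ((Rat.HeightOneSpectrum.primesEquiv (R := 𝓞 ℚ)).symm ⟨3, Fact.out⟩))
      (hinj : (bdRPeriodRingData (valuation_place_lt_one 3 ((Rat.HeightOneSpectrum.primesEquiv (R := 𝓞 ℚ)).symm ⟨3, Fact.out⟩))).CupLogInjective (logCyclotomic 3)
        (localRationalTateRep W 3 (galRestrictPlace ((Rat.HeightOneSpectrum.primesEquiv (R := 𝓞 ℚ)).symm ⟨3, Fact.out⟩))))
      (hex : ∀ z : contOneCocycles (localRationalTateRep W 3 (galRestrictPlace ((Rat.HeightOneSpectrum.primesEquiv (R := 𝓞 ℚ)).symm ⟨3, Fact.out⟩))).toTopRep,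
        (bdRPeriodRingData (valuation_place_lt_one 3 ((Rat.HeightOneSpectrum.primesEquiv (R := 𝓞 ℚ)).symm ⟨3, Fact.out⟩))).HasDualExp (logCyclotomic 3)
          (localRationalTateRep W 3 (galRestrictPlace ((Rat.HeightOneSpectrum.primesEquiv (R := 𝓞 ℚ)).symm ⟨3, Fact.out⟩))) fun σ => z.1 σ),
    (∃ y, expStarOmegaAt d y ≠ 0) →
    ∀ (Ψ : ℚ_[3] ⊗[ℚ] CyclotomicField (cycLevel 3 k r) ℚ ≃ₐ[ℚ]
      (Π w : ((Rat.HeightOneSpectrum.primesEquiv (R := 𝓞 ℚ)).symm ⟨3, Fact.out⟩).Extension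
        (𝓞 (CyclotomicField (cycLevel 3 k r) ℚ)), w.1.adicCompletion (CyclotomicField (cycLevel 3 k r) ℚ)))
    (hΨ : ∀ (s : ℚ_[3]) (x : CyclotomicField (cycLevel 3 k r) ℚ)
      (w : ((Rat.HeightOneSpectrum.primesEquiv (R := 𝓞 ℚ)).symm ⟨3, Fact.out⟩).Extension
        (𝓞 (CyclotomicField (cycLevel 3 k r) ℚ))),
      Ψ (s ⊗ₜ[ℚ] x) w =
        algebraMap (CyclotomicField (cycLevel 3 k r) ℚ) (w.1.adicCompletion (CyclotomicField (cycLevel 3 k r) ℚ)) x *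
        algebraMap (((Rat.HeightOneSpectrum.primesEquiv (R := 𝓞 ℚ)).symm ⟨3, Fact.out⟩).adicCompletion ℚ)
          (w.1.adicCompletion (CyclotomicField (cycLevel 3 k r) ℚ)) ((Padic.adicCompletionEquiv (𝓞 ℚ) ⟨3, Fact.out⟩) s))
    (w₀ : ((Rat.HeightOneSpectrum.primesEquiv (R := 𝓞 ℚ)).symm ⟨3, Fact.out⟩).Extension
        (𝓞 (CyclotomicField (cycLevel 3 k r) ℚ)))
      (g : ((Rat.HeightOneSpectrum.primesEquiv (R := 𝓞 ℚ)).symm ⟨3, Fact.out⟩).Extension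
        (𝓞 (CyclotomicField (cycLevel 3 k r) ℚ)) → absoluteGaloisGroup ℚ)
      (hg : ∀ w : ((Rat.HeightOneSpectrum.primesEquiv (R := 𝓞 ℚ)).symm ⟨3, Fact.out⟩).Extension
        (𝓞 (CyclotomicField (cycLevel 3 k r) ℚ)),
        sigma (cycLevel 3 k r) (modNCyclotomicCharacter ℚ (cycLevel 3 k r) (g w)) • w.1 = w₀.1),
    letI := LocalField.charZero_adicCompletion w₀.1
    letI := LocalField.adicCompletionPadicAlgebra w₀.1 3 (three_mem_asIdeal_extension _ w₀)
    haveI : Fact (¬ IsUnit ((3 : ℕ) : integerC (w₀.1.adicCompletion (CyclotomicField (cycLevel 3 k r) ℚ)))) :=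
      ⟨not_isUnit_natCast_integerC (LocalField.valuation_adicCompletion_natCast_lt_one w₀.1 3 (three_mem_asIdeal_extension _ w₀))⟩
    haveI := isAdicComplete_integerC_natCast (LocalField.valuation_adicCompletion_natCast_lt_one w₀.1 3 (three_mem_asIdeal_extension _ w₀))
    ∀ (dw : LocalNeronLine W (LocalField.valuation_adicCompletion_natCast_lt_one w₀.1 3 (three_mem_asIdeal_extension _ w₀))
      ((galRestrictPlace ((Rat.HeightOneSpectrum.primesEquiv (R := 𝓞 ℚ)).symm ⟨3, Fact.out⟩)).comp
        (absGaloisRestrict (((Rat.HeightOneSpectrum.primesEquiv (R := 𝓞 ℚ)).symm ⟨3, Fact.out⟩).adicCompletion ℚ) (w₀.1.adicCompletion (CyclotomicField (cycLevel 3 k r) ℚ)))))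
      (hinjw : (bdRPeriodRingData (LocalField.valuation_adicCompletion_natCast_lt_one w₀.1 3 (three_mem_asIdeal_extension _ w₀))).CupLogInjective
      (logCyclotomic 3) (localRationalTateRep W 3 ((galRestrictPlace ((Rat.HeightOneSpectrum.primesEquiv (R := 𝓞 ℚ)).symm ⟨3, Fact.out⟩)).comp
        (absGaloisRestrict (((Rat.HeightOneSpectrum.primesEquiv (R := 𝓞 ℚ)).symm ⟨3, Fact.out⟩).adicCompletion ℚ) (w₀.1.adicCompletion (CyclotomicField (cycLevel 3 k r) ℚ))))))
      (hexw : ∀ z : contOneCocycles (localRationalTateRep W 3 ((galRestrictPlace ((Rat.HeightOneSpectrum.primesEquiv (R := 𝓞 ℚ)).symm ⟨3, Fact.out⟩)).comp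
        (absGaloisRestrict (((Rat.HeightOneSpectrum.primesEquiv (R := 𝓞 ℚ)).symm ⟨3, Fact.out⟩).adicCompletion ℚ) (w₀.1.adicCompletion (CyclotomicField (cycLevel 3 k r) ℚ))))).toTopRep,
      (bdRPeriodRingData (LocalField.valuation_adicCompletion_natCast_lt_one w₀.1 3 (three_mem_asIdeal_extension _ w₀))).HasDualExp
        (logCyclotomic 3) (localRationalTateRep W 3 ((galRestrictPlace ((Rat.HeightOneSpectrum.primesEquiv (R := 𝓞 ℚ)).symm ⟨3, Fact.out⟩)).comp
        (absGaloisRestrict (((Rat.HeightOneSpectrum.primesEquiv (R := 𝓞 ℚ)).symm ⟨3, Fact.out⟩).adicCompletion ℚ) (w₀.1.adicCompletion (CyclotomicField (cycLevel 3 k r) ℚ))))) fun σ => z.1 σ),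
    (∀ (h : (tateLocalRep W 3 (Sum.inr ((Rat.HeightOneSpectrum.primesEquiv (R := 𝓞 ℚ)).symm ⟨3, Fact.out⟩))).cohomology 1),
      (expStarOmegaHom (LocalField.valuation_adicCompletion_natCast_lt_one w₀.1 3 (three_mem_asIdeal_extension _ w₀))
        ((galRestrictPlace ((Rat.HeightOneSpectrum.primesEquiv (R := 𝓞 ℚ)).symm ⟨3, Fact.out⟩)).comp
        (absGaloisRestrict (((Rat.HeightOneSpectrum.primesEquiv (R := 𝓞 ℚ)).symm ⟨3, Fact.out⟩).adicCompletion ℚ) (w₀.1.adicCompletion (CyclotomicField (cycLevel 3 k r) ℚ)))) dw hinjw hexw)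
        (ContinuousRep.cohomologyRes (tateLocalRep W 3 (Sum.inr ((Rat.HeightOneSpectrum.primesEquiv (R := 𝓞 ℚ)).symm ⟨3, Fact.out⟩)))
          (absGaloisRestrict (((Rat.HeightOneSpectrum.primesEquiv (R := 𝓞 ℚ)).symm ⟨3, Fact.out⟩).adicCompletion ℚ) (w₀.1.adicCompletion (CyclotomicField (cycLevel 3 k r) ℚ))) 1 h) =
      algebraMap (((Rat.HeightOneSpectrum.primesEquiv (R := 𝓞 ℚ)).symm ⟨3, Fact.out⟩).adicCompletion ℚ) (w₀.1.adicCompletion (CyclotomicField (cycLevel 3 k r) ℚ)) (expStarOmegaAt d h)) →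
    (∀ (σ : absoluteGaloisGroup ℚ) (y : H1 (tateRep W 3) (cycSubgroup 3 k r)),
      (katoLambda W 3 k r w₀ Ψ hΨ (three_mem_asIdeal_extension _ w₀) g hg dw hinjw hexw) (conjMap (tateRep W 3).toTopRep (cycSubgroup 3 k r) σ 1 y) =
        Algebra.TensorProduct.map (AlgHom.id ℚ ℚ_[3])
          (sigma (cycLevel 3 k r) (modNCyclotomicCharacter ℚ (cycLevel 3 k r) σ) :
            CyclotomicField (cycLevel 3 k r) ℚ →ₐ[ℚ] CyclotomicField (cycLevel 3 k r) ℚ) ((katoLambda W 3 k r w₀ Ψ hΨ (three_mem_asIdeal_extension _ w₀) g hg dw hinjw hexw) y)) ∧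
    (∀ (y : H1 (tateRep W 3) (cycSubgroup 3 k r)),
      (∀ v : HeightOneSpectrum (𝓞 ℚ), ((Rat.HeightOneSpectrum.primesEquiv v : Nat.Primes) : ℕ) = 3 →
        ∀ 𝔓 ∈ v.primesAbove, resLe (tateRep W 3).toTopRep
          (inf_le_left : cycSubgroup 3 k r ⊓ MulAction.stabilizer (absoluteGaloisGroup ℚ) 𝔓 ≤ cycSubgroup 3 k r) 1 y = 0) →
      (katoLambda W 3 k r w₀ Ψ hΨ (three_mem_asIdeal_extension _ w₀) g hg dw hinjw hexw) y = 0) := by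

  haveI : Fact (((3 : ℕ) : 𝓞 ℚ) ∈ ((Rat.HeightOneSpectrum.primesEquiv (R := 𝓞 ℚ)).symm ⟨3, Fact.out⟩).asIdeal) :=
    ⟨(natCast_mem_asIdeal_iff_eq_primesEquiv_symm _ Nat.prime_three).mpr rfl⟩
  letI := valuativeRelPlace ((Rat.HeightOneSpectrum.primesEquiv (R := 𝓞 ℚ)).symm ⟨3, Fact.out⟩)
  letI := topologicalSpacePlace ((Rat.HeightOneSpectrum.primesEquiv (R := 𝓞 ℚ)).symm ⟨3, Fact.out⟩)
  haveI := isNonarchimedeanLocalField_place ((Rat.HeightOneSpectrum.primesEquiv (R := 𝓞 ℚ)).symm ⟨3, Fact.out⟩)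
  haveI := charZero_place ((Rat.HeightOneSpectrum.primesEquiv (R := 𝓞 ℚ)).symm ⟨3, Fact.out⟩)
  letI := padicAlgebraPlace 3 ((Rat.HeightOneSpectrum.primesEquiv (R := 𝓞 ℚ)).symm ⟨3, Fact.out⟩)
  haveI := fact_not_isUnit_place 3 ((Rat.HeightOneSpectrum.primesEquiv (R := 𝓞 ℚ)).symm ⟨3, Fact.out⟩)
  haveI := isAdicComplete_place 3 ((Rat.HeightOneSpectrum.primesEquiv (R := 𝓞 ℚ)).symm ⟨3, Fact.out⟩)
  intro d hinj hex hne Ψ hΨ w₀ g hg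
  letI := LocalField.charZero_adicCompletion w₀.1
  letI := LocalField.adicCompletionPadicAlgebra w₀.1 3 (three_mem_asIdeal_extension _ w₀)
  haveI : Fact (¬ IsUnit ((3 : ℕ) : integerC (w₀.1.adicCompletion (CyclotomicField (cycLevel 3 k r) ℚ)))) :=
    ⟨not_isUnit_natCast_integerC (LocalField.valuation_adicCompletion_natCast_lt_one w₀.1 3 (three_mem_asIdeal_extension _ w₀))⟩
  haveI := isAdicComplete_integerC_natCast (LocalField.valuation_adicCompletion_natCast_lt_one w₀.1 3 (three_mem_asIdeal_extension _ w₀))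
  intro dw hinjw hexw hresw
  exact zetaBody_C3_of_level_of_ne_zero W k r
    (katoLambda W 3 k r w₀ Ψ hΨ (three_mem_asIdeal_extension _ w₀) g hg dw hinjw hexw)
    d hinj hex hne Ψ hΨ w₀ g hg dw hinjw hexw hresw
    (fun w y φ'' ψT hφ'' hψT =>
      cocycleDef_katoLambda W 3 k r w₀ Ψ hΨ (three_mem_asIdeal_extension _ w₀) g hg dw hinjw hexw w y φ'' ψT hφ'' hψT)

end Summit.BirchSwinnertonDyer.BirchSwinnertonDyer.Theorems.KimAtThreeFineKatoDefinedLambdaC3Uniform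

end
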